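import Literature.Geometry.Riemannian.BoundaryMetricExtension
import Literature.Geometry.Riemannian.OrthonormalFrameBounds
import Literature.Geometry.Riemannian.ChangGurskyYangProofs
import Literature.Geometry.Lorentzian.Hypersurface
import Literature.Geometry.Lorentzian.IsometryProofs
import Literature.Topology.FourManifolds.ImmersionOrientation
import HarnessLib

/-!
# Steps of Shi–Wang–Wei's proof of the boundary-metric extension theorem (Thm. 1.1)

Topic `Literature/Geometry/Riemannian`. Companion of `BoundaryMetricExtension.lean`, which vends
the named fact `ShiWangWei2022_boundaryMetric_extends_psc` (Shi–Wang–Wei, J. reine angew. Math.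
784 (2022), Thm. 1.1: on a compact connected manifold `X` with non-empty boundary every metric
`γ` on `∂X` is induced by a Riemannian metric of positive scalar curvature on `X`). The printed
proof (ibid. §2; p. 7 of arXiv:2007.06756) runs: (0) a PSC metric `g₁` on
`X` ([KW, Thm. 1.4] / [Gro69, Thm. 4.5.1]); (1) "Denote the induced metric on `Y` from `g₁` by
`γ₁` … We may assume `γ₁ > γ` after a suitable rescaling"; (2) the PSC-cobordism of Lemma 2.1
from `(Y, γ)` to `(Y, γ₁)`; (3) gluing, Miao's mollification of the corner and a conformal
deformation preserving the boundary metric; (4) `X̃ ≅ X`.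

This file PROVES step (1) in the vocabulary of the fact, bottom-up (D-0026: inline lemmas, no
new named facts):

* `exists_nhds_val_le_mul_val`, `exists_val_le_mul_val`, `exists_val_lt_mul_val` — **two
  Riemannian metrics on a compact manifold are uniformly comparable**: for `C^∞` metrics `g`,
  `g'` on `TM`, `g'` Riemannian, `M` compact, there is `c > 0` with `g_x(v,v) ≤ c g'_x(v,v)`
  (and `<` on `v ≠ 0`) — locally, in the frame of a trivialization of `TM`, the Gram entries of
  `g` are bounded (continuity on a compact neighbourhood) and `g'` is uniformly positive definite
  (`exists_pos_mul_norm_sq_le_val`, `OrthonormalFrameBounds.lean`); globally by a finite subcover.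
  Folklore (e.g. the remark "any two Riemannian metrics on a compact manifold are bi-Lipschitz
  equivalent").
* `isSpacelikeImmersion_incl` — the boundary inclusion of a boundary datum is a spacelike
  immersion for every Riemannian metric (its differential is injective:
  `injective_mfderiv_of_isImmersionAt'`), so that `γ₁ = incl^* g₁` is a smooth Riemannian metric
  on the boundary manifold (`PseudoRiemannianMetric.inducedMetric`, smoothness by
  `contMDiff_pullbackBilin_holds`).
* `ShiWangWei2022_rescaling_step` — **step (1) as printed**: given a Riemannian metric `g₁` of
  positive scalar curvature on a compact manifold with boundary `X` and any smooth metric `γ` on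
  the boundary manifold, some constant multiple `c g₁`, `c > 0`, is again Riemannian with
  Levi-Civita connection and positive scalar curvature (`S(c g) = c⁻¹ S(g)`,
  `scalarCurvature_constSmul`) and its induced boundary form strictly dominates `γ`:
  `γ_z(v,v) < (incl^*(c g₁))_z(v,v)` for `v ≠ 0` — the hypothesis `γ₁ > γ₀` of Lemma 2.1.

Steps (0), (2)–(4) are not in the tree (see the module docstring of `BoundaryMetricExtension.lean`,
"Size of a discharge").

## References

* Y. Shi, W. Wang, G. Wei, *Total mean curvature of the boundary and nonnegative scalar curvature
  fill-ins*, J. reine angew. Math. 784 (2022) 215–250 = arXiv:2007.06756, §2, proof of Thm. 1.1.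
  [ShiWangWei2022]
-/

noncomputable section

open Bundle Set Function Filter
open scoped Manifold ContDiff Topology BigOperators

namespace Literature.Geometry.Riemannian

open Lorentzian Lorentzian.PseudoRiemannianMetric Literature.Topology.FourManifolds

universe u

section Comparison

variable {E : Type*} [NormedAddCommGroup E] [NormedSpace ℝ E] {H : Type*} [TopologicalSpace H]
  {I : ModelWithCorners ℝ E H} {M : Type*} [TopologicalSpace M] [ChartedSpace H M]
  [IsManifold I ∞ M] [FiniteDimensional ℝ E] [T2Space M]

/-- **Local uniform comparability of two metrics.** For `C^∞` pseudo-Riemannian metrics `g`, `g'`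
on `TM` with `g'` Riemannian, every point has a neighbourhood `U` and a constant `c > 0` with
`g_x(v, v) ≤ c · g'_x(v, v)` for all `x ∈ U`, `v ∈ T_x M`: in the local frame `sᵢ` of the
trivialization of `TM` at `x₀`, over a compact neighbourhood `K` of `x₀`, the Gram entries
`g_x(sᵢ, sⱼ)` are bounded (continuous on `K`) and `λ ‖w‖² ≤ g'_x(Σ wᵢ sᵢ, Σ wᵢ sᵢ)`
(`exists_pos_mul_norm_sq_le_val`). Used for "we may assume `γ₁ > γ` after a suitable rescaling"
(Shi–Wang–Wei 2022, proof of Thm. 1.1). [folklore] -/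
theorem exists_nhds_val_le_mul_val [LocallyCompactSpace M]
    (g g' : PseudoRiemannianMetric I ∞ E (TangentSpace I : M → Type _)) (hg' : g'.IsRiemannian)
    (x₀ : M) :
    ∃ U ∈ 𝓝 x₀, ∃ c : ℝ, 0 < c ∧ ∀ x ∈ U, ∀ v : TangentSpace I x,
      g.val x v v ≤ c * g'.val x v v := by
  classical
  set e₀ := trivializationAt E (TangentSpace I : M → Type _) x₀ with he₀
  set bE := Module.finBasis ℝ E with hbE
  have hx₀ : x₀ ∈ e₀.baseSet := FiberBundle.mem_baseSet_trivializationAt E _ x₀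
  -- a compact neighbourhood of `x₀` inside the base set
  obtain ⟨K, hK_nhds, hK_sub, hK_comp⟩ := local_compact_nhds (e₀.open_baseSet.mem_nhds hx₀)
  -- uniform positive-definiteness of `g'` in the frame over `K`
  obtain ⟨lam, hlam, hlamle⟩ := exists_pos_mul_norm_sq_le_val e₀ bE hg' hK_comp hK_sub
  -- a bound for the Gram entries of `g` over `K`
  set G : Fin (Module.finrank ℝ E) → Fin (Module.finrank ℝ E) → M → ℝ := fun i j x ↦
    g.val x (e₀.localFrame bE i x) (e₀.localFrame bE j x) with hGdef
  have hG : ∀ i j, ContinuousOn (G i j) e₀.baseSet := fun i j ↦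
    (contMDiffOn_gram_localFrame e₀ g bE i j).continuousOn
  set S : M → ℝ := fun x ↦ ∑ i, ∑ j, ‖G i j x‖ with hS
  have hScont : ContinuousOn S K := by
    refine continuousOn_finsetSum _ fun i _ ↦ continuousOn_finsetSum _ fun j _ ↦ ?_
    exact ((hG i j).mono hK_sub).norm
  obtain ⟨B, hB⟩ := hK_comp.exists_bound_of_continuousOn hScont
  set B' : ℝ := max B 0 with hB'
  have hB'0 : 0 ≤ B' := le_max_right _ _
  refine ⟨K, hK_nhds, B' / lam + 1, by positivity, fun x hx v ↦ ?_⟩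
  have hxe : x ∈ e₀.baseSet := hK_sub hx
  -- coefficients of `v` in the local frame
  set w : Fin (Module.finrank ℝ E) → ℝ := fun i ↦ (e₀.basisAt bE hxe).repr v i with hw
  have hv : (∑ i, w i • e₀.localFrame bE i x) = v := by
    simp only [hw, e₀.localFrame_apply_of_mem_baseSet bE hxe]
    exact (e₀.basisAt bE hxe).sum_repr v
  -- lower bound for `g'`
  have hg'v : lam * ‖w‖ ^ 2 ≤ g'.val x v v := by
    have := hlamle x hx w
    rwa [hv] at this
  have hg'nonneg : 0 ≤ g'.val x v v :=
    le_trans (mul_nonneg hlam.le (sq_nonneg _)) hg'v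
  -- upper bound for `g`
  have hSx : S x ≤ B' := by
    have h1 : S x ≤ ‖S x‖ := Real.le_norm_self _
    exact h1.trans ((hB x hx).trans (le_max_left _ _))
  have hgv : g.val x v v ≤ B' * ‖w‖ ^ 2 := by
    have h1 : g.val x v v = ∑ i, ∑ j, w i * w j * G i j x := by
      rw [← hv]
      exact val_sum_smul_sum_smul g x w w _ _
    have h2 : g.val x v v ≤ ∑ i, ∑ j, ‖w‖ * ‖w‖ * ‖G i j x‖ := by
      rw [h1]
      refine Finset.sum_le_sum fun i _ ↦ Finset.sum_le_sum fun j _ ↦ ?_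
      calc w i * w j * G i j x ≤ ‖w i * w j * G i j x‖ := Real.le_norm_self _
        _ = ‖w i‖ * ‖w j‖ * ‖G i j x‖ := by rw [norm_mul, norm_mul]
        _ ≤ ‖w‖ * ‖w‖ * ‖G i j x‖ := by
          gcongr
          · exact norm_le_pi_norm w i
          · exact norm_le_pi_norm w j
    have h3 : (∑ i, ∑ j, ‖w‖ * ‖w‖ * ‖G i j x‖) = ‖w‖ * ‖w‖ * S x := by
      simp only [hS, Finset.mul_sum]
    rw [h3] at h2
    calc g.val x v v ≤ ‖w‖ * ‖w‖ * S x := h2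
      _ ≤ ‖w‖ * ‖w‖ * B' := by gcongr
      _ = B' * ‖w‖ ^ 2 := by ring
  -- combine
  have hw2 : ‖w‖ ^ 2 ≤ g'.val x v v / lam := by
    rw [le_div_iff₀ hlam, mul_comm]
    exact hg'v
  calc g.val x v v ≤ B' * ‖w‖ ^ 2 := hgv
    _ ≤ B' * (g'.val x v v / lam) := mul_le_mul_of_nonneg_left hw2 hB'0
    _ = (B' / lam) * g'.val x v v := by ring
    _ ≤ (B' / lam + 1) * g'.val x v v := by nlinarith

/-- **Two metrics on a compact manifold are uniformly comparable**: for `C^∞` pseudo-Riemannian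
metrics `g`, `g'` on the tangent bundle of a compact manifold with `g'` Riemannian there is
`c > 0` with `g_x(v, v) ≤ c · g'_x(v, v)` for all `x`, `v` (finite subcover of
`exists_nhds_val_le_mul_val`). [folklore] -/
theorem exists_val_le_mul_val [CompactSpace M]
    (g g' : PseudoRiemannianMetric I ∞ E (TangentSpace I : M → Type _)) (hg' : g'.IsRiemannian) :
    ∃ c : ℝ, 0 < c ∧ ∀ (x : M) (v : TangentSpace I x), g.val x v v ≤ c * g'.val x v v := by
  choose U hU c hc hle using fun x₀ ↦ exists_nhds_val_le_mul_val g g' hg' x₀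
  obtain ⟨t, -, ht⟩ := isCompact_univ.elim_nhds_subcover U fun x _ ↦ hU x
  refine ⟨1 + ∑ y ∈ t, c y,
    add_pos_of_pos_of_nonneg one_pos (Finset.sum_nonneg fun y _ ↦ (hc y).le), fun x v ↦ ?_⟩
  obtain ⟨x₀, hx₀t, hxU⟩ : ∃ x₀ ∈ t, x ∈ U x₀ := by
    simpa only [mem_iUnion, exists_prop] using ht (mem_univ x)
  have h1 := hle x₀ x hxU v
  have hnonneg : 0 ≤ g'.val x v v := by
    by_cases hv : v = 0
    · simp [hv]
    · exact (hg' x v hv).le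
  have hcle : c x₀ ≤ 1 + ∑ y ∈ t, c y :=
    (Finset.single_le_sum (fun y _ ↦ (hc y).le) hx₀t).trans (le_add_of_nonneg_left zero_le_one)
  exact h1.trans (mul_le_mul_of_nonneg_right hcle hnonneg)

/-- Strict form of `exists_val_le_mul_val`: there is `c > 0` with `g_x(v, v) < c · g'_x(v, v)` for
all nonzero `v` (enlarge the constant by `1`, using `g'_x(v, v) > 0`). This is the rescaling
constant of "we may assume `γ₁ > γ` after a suitable rescaling" (Shi–Wang–Wei 2022, proof of
Thm. 1.1, with `g = γ`, `g' = γ₁`). [folklore] -/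
theorem exists_val_lt_mul_val [CompactSpace M]
    (g g' : PseudoRiemannianMetric I ∞ E (TangentSpace I : M → Type _)) (hg' : g'.IsRiemannian) :
    ∃ c : ℝ, 0 < c ∧ ∀ (x : M) (v : TangentSpace I x), v ≠ 0 →
      g.val x v v < c * g'.val x v v := by
  obtain ⟨c, hc, hle⟩ := exists_val_le_mul_val g g' hg'
  refine ⟨c + 1, by positivity, fun x v hv ↦ ?_⟩
  have hpos : 0 < g'.val x v v := hg' x v hv
  calc g.val x v v ≤ c * g'.val x v v := hle x v
    _ < (c + 1) * g'.val x v v := by nlinarith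

end Comparison

/-! ### The boundary inclusion is a spacelike immersion; the rescaling step -/

section Rescaling

variable {m : ℕ} {X : Type u} [TopologicalSpace X]
  [ChartedSpace (EuclideanHalfSpace (m + 3)) X] [IsManifold (𝓡∂ (m + 3)) ∞ X]

/-- **The boundary inclusion is a spacelike immersion** for every Riemannian metric `g` on a
manifold with boundary `X`: `incl` is `C^∞` and `g(d incl v, d incl v) > 0` for `v ≠ 0` because
the differential of the smooth embedding `incl` is injective
(`injective_mfderiv_of_isImmersionAt'`). Hence `incl^* g` is a Riemannian metric on the boundary
manifold (`PseudoRiemannianMetric.inducedMetric`). O'Neill 1983, Ch. 4, p. 97 (semi-Riemannian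
submanifolds and hypersurfaces). [folklore] -/
theorem isSpacelikeImmersion_incl (bX : BoundaryData (𝓡∂ (m + 3)) X (𝓡 (m + 2)))
    (g : PseudoRiemannianMetric (𝓡∂ (m + 3)) ∞ (EuclideanSpace ℝ (Fin (m + 3)))
      (TangentSpace (𝓡∂ (m + 3)) : X → Type _)) (hg : g.IsRiemannian) :
    g.IsSpacelikeImmersion (𝓡 (m + 2)) bX.incl := by
  refine ⟨?_, fun z v hv ↦ ?_⟩
  · exact bX.isSmoothEmbedding.contMDiff
  · rw [inducedBilin_apply]
    have hinj := injective_mfderiv_of_isImmersionAt'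
      (bX.isSmoothEmbedding.isImmersion.isImmersionAt z)
    refine hg _ _ fun h ↦ hv (hinj ?_)
    rw [h, map_zero]

/-- **Step (1) of the proof of Shi–Wang–Wei's Thm. 1.1 ("we may assume `γ₁ > γ` after a suitable
rescaling").** Let `X` be a compact smooth `(m+3)`-manifold with boundary datum `bX`, `g₁` a smooth
Riemannian metric on `X` with Levi-Civita connection and positive scalar curvature, and `γ` any
smooth metric on the boundary manifold. Then for some constant `c > 0` the rescaled metric
`c g₁` is Riemannian, has a Levi-Civita connection (the same one, `HasLeviCivita.constSmul`) and
positive scalar curvature `S(c g₁) = c⁻¹ S(g₁) > 0` (`scalarCurvature_constSmul`), and its induced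
boundary form strictly dominates `γ`: `γ_z(v, v) < (incl^*(c g₁))_z(v, v) = c (incl^* g₁)_z(v, v)`
for `v ≠ 0` (the boundary manifold is compact, `BoundaryData.compactSpace_carrier`, so
`exists_val_lt_mul_val` applies to `γ` and `γ₁ = incl^* g₁`). Shi–Wang–Wei 2022, proof of
Thm. 1.1, second and fourth sentences. [cite: ShiWangWei2022, proof of Thm. 1.1] -/
theorem ShiWangWei2022_rescaling_step [T2Space X] [CompactSpace X]
    (bX : BoundaryData (𝓡∂ (m + 3)) X (𝓡 (m + 2)))
    (g₁ : PseudoRiemannianMetric (𝓡∂ (m + 3)) ∞ (EuclideanSpace ℝ (Fin (m + 3)))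
      (TangentSpace (𝓡∂ (m + 3)) : X → Type _)) [g₁.HasLeviCivita]
    (hg₁ : g₁.IsRiemannian) (hS : ∀ x, 0 < g₁.scalarCurvature x)
    (γ : PseudoRiemannianMetric (𝓡 (m + 2)) ∞ (EuclideanSpace ℝ (Fin (m + 2)))
      (TangentSpace (𝓡 (m + 2)) : bX.carrier → Type _)) :
    ∃ (c : ℝ) (hc : 0 < c), ∃ _ : (g₁.constSmul c hc.ne').HasLeviCivita,
      (g₁.constSmul c hc.ne').IsRiemannian ∧
      (∀ x, 0 < (g₁.constSmul c hc.ne').scalarCurvature x) ∧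
      ∀ (z : bX.carrier) (v : TangentSpace (𝓡 (m + 2)) z), v ≠ 0 →
        γ.val z v v < pullbackBilin (I := 𝓡∂ (m + 3)) (I' := 𝓡 (m + 2)) bX.incl
          (g₁.constSmul c hc.ne').val z v v := by
  haveI : T2Space bX.carrier := bX.isSmoothEmbedding.isEmbedding.t2Space
  haveI : CompactSpace bX.carrier := bX.compactSpace_carrier
  -- the induced boundary metric `γ₁ = incl^* g₁`
  have hf : g₁.IsSpacelikeImmersion (𝓡 (m + 2)) bX.incl := isSpacelikeImmersion_incl bX g₁ hg₁
  set γ₁ := g₁.inducedMetric bX.incl contMDiff_pullbackBilin_holds hf with hγ₁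
  have hγ₁R : γ₁.IsRiemannian := isRiemannian_inducedMetric _ _ _ hf
  obtain ⟨c, hc, hlt⟩ := exists_val_lt_mul_val γ γ₁ hγ₁R
  haveI hLC : (g₁.constSmul c hc.ne').HasLeviCivita := HasLeviCivita.constSmul c hc.ne'
  refine ⟨c, hc, hLC, hg₁.constSmul hc, fun x ↦ ?_, fun z v hv ↦ ?_⟩
  · rw [scalarCurvature_constSmul c hc.ne' x]
    exact mul_pos (inv_pos.mpr hc) (hS x)
  · have h := hlt z v hv
    have hγ₁v : γ₁.val z v v = g₁.val (bX.incl z) (mfderiv (𝓡 (m + 2)) (𝓡∂ (m + 3)) bX.incl z v)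
        (mfderiv (𝓡 (m + 2)) (𝓡∂ (m + 3)) bX.incl z v) := rfl
    rw [pullbackBilin_apply, constSmul_apply, ← hγ₁v]
    exact h

end Rescaling

end Literature.Geometry.Riemannian

end
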